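import Summits.CriticalPhenomena.PercolationContinuityZ3.Theorems.PercNearOneGluingNoHeavyLowerTailFrontierDecRowsPinnedEdgeKeyAll
import HarnessLib

/-!
# The pinned-terminal schema with the STRONG induction hypothesis: at the step, `E₃ ≥ 0` for EVERY weight with fewer fractional pairs

Support file (prover seat `prim-bnk-1`, gen 11; `--supports stmt-CriticalPhenomena-4575`).  No named facts, no sorries, no `native_decide`;
bookkeeping definitions `StrongIH`, `PinnedFamilyHypStrong`, `KeyHypAtStrong`.  Sequel of prim-l12-p6's `…PinnedEdgeAllMarkings` /
`…PinnedEdgeKeyAll` (whose proofs are reused verbatim up to the hypothesis plumbing) and of bnk-1 gen 9's `…UnmarkedEdgeKey`.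

WHY.  The induction behind `sahiE3_pev_nonneg_of_pinnedFamilyHyp` runs on the number of FRACTIONAL PAIRS, simultaneously over all dimensions, all
rows of the family and all injective markings; its induction hypothesis one level down is therefore the FULL statement for every weight function (of
any dimension) with strictly fewer fractional pairs — not only for the two updates `w[e↦0]`, `w[e↦1]` that `PinnedFamilyHyp` / `KeyHypAtAll`
hand to the step.  In particular every SURE GLUING of `G∖e` (a further pair set to weight `1`: the rows of the family read on the quotient
graphs `(G∖e)/{x=y}`, which are polynomial in the SAME five-point cells) is an admissible induction-hypothesis row when certifying the single cubic
`K = 3B₁ − 2B₀ ≥ 0` at the edge `(x i₀, u)`.  Numerically (prim-bnk-1 gen 11, memo FROM-prim-bnk-1-gen11) these glued rows are exactly what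
separates the 52-cell point pseudo-laws of `K_PATH` at the hub (which exist under the `μ⁰/μ¹`-only hypotheses) from the realizable laws; this file
makes them legitimate in the kernel (cf. prim-sahi-p2's `IncStar.incStar_nonneg_of_rootEdgeBernsteinStrongIH` for the increasing star).

* `StrongIH Φ₁ Φ₂ Φ₃ w` — `0 ≤ E₃(row r' at x')` for every `r'`, every dimension `n'`, every `w'` with `(frac w').card < (frac w).card`, every injective `x'`;
* `PinnedFamilyHypStrong Φ₁ Φ₂ Φ₃ i₀ m` — at a FRACTIONAL edge `e = s(x (i₀ r), u)`, `StrongIH … w` ⟹ both polarised coefficients of row `r` at `x` along `e` are `≥ 0`;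
  `PinnedFamilyHyp.toStrong`; **`sahiE3_pev_nonneg_of_pinnedFamilyHypStrong`** (same conclusion as p6's theorem, weaker hypothesis);
* `KeyHypAtStrong i₀ Φ₁ Φ₂ Φ₃ m` — the single-row KEY form (`0 ≤ key μ_{w[e↦0]} μ_{w[e↦1]}` from `StrongIH`), `pinnedFamilyHypStrong_of_keyHypAtStrong`
  (decreasing pattern rows), **`sahiE3_sepPat_nonneg_of_keyHypAtStrong`** (first separation pinned at `i₀`);
* corollaries: **`frontier_36_all_of_keyAtStrong_hub`** (PATH, `K ≥ 0` at the hub `a`), **`frontier_44_all_of_keyAtStrong`** (row 44 at `a`).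
-/

noncomputable section

namespace Summit.CriticalPhenomena.PercolationContinuityZ3.Theorems

namespace TerminalEdgeInduction

open MeasureTheory Literature.Probability.Percolation Literature.Probability.LatticeModels
open EdgeInduction CovTransferCert E3GroupSepCert
open scoped Classical

variable {n k : ℕ} {ι : Type*}

/-! ### The strong induction hypothesis and the strong pinned-family package -/

/-- **Strong induction hypothesis at `w`** for a family of pattern triples: `0 ≤ E₃(pev (Φ₁ r') x', pev (Φ₂ r') x', pev (Φ₃ r') x')` under
`prodBernoulli w'` for EVERY row `r'`, EVERY dimension `n'`, EVERY weight function `w'` with strictly fewer fractional pairs than `w`, and every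
injective marking `x'`. [this work] -/
def StrongIH (Φ₁ Φ₂ Φ₃ : ι → (Fin k → Fin k → Bool) → Bool) {m : ℕ} (w : Sym2 (Fin m) → unitInterval) : Prop :=
  ∀ (n' : ℕ) (w' : Sym2 (Fin n') → unitInterval), (frac w').card < (frac w).card →
    ∀ (r' : ι) (x' : Fin k → Fin n'), Function.Injective x' →
      0 ≤ sahiE3 (prodBernoulli w') (pev (Φ₁ r') x') (pev (Φ₂ r') x') (pev (Φ₃ r') x')

/-- **Pinned-family hypotheses with the STRONG induction hypothesis, at dimension `m`**: for every `w`, row `r`, injective `x`, unmarked `u`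
with `e = s(x (i₀ r), u)` FRACTIONAL: `StrongIH Φ₁ Φ₂ Φ₃ w` ⟹ both polarised Bernstein coefficients of row `r` at `x` along `e` are `≥ 0`. [this work] -/
def PinnedFamilyHypStrong (Φ₁ Φ₂ Φ₃ : ι → (Fin k → Fin k → Bool) → Bool) (i₀ : ι → Fin k) (m : ℕ) : Prop :=
  ∀ (w : Sym2 (Fin m) → unitInterval) (r : ι) (x : Fin k → Fin m), Function.Injective x → ∀ (u : Fin m), (∀ j, x j ≠ u) →
    s(x (i₀ r), u) ∈ frac w → StrongIH Φ₁ Φ₂ Φ₃ w →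
    0 ≤ polar₁ (prodBernoulli (Function.update w s(x (i₀ r), u) 0)) (prodBernoulli (Function.update w s(x (i₀ r), u) 1))
        (pev (Φ₁ r) x) (pev (Φ₂ r) x) (pev (Φ₃ r) x) ∧
    0 ≤ polar₁ (prodBernoulli (Function.update w s(x (i₀ r), u) 1)) (prodBernoulli (Function.update w s(x (i₀ r), u) 0))
        (pev (Φ₁ r) x) (pev (Φ₂ r) x) (pev (Φ₃ r) x)

/-- The strong hypothesis contains the two same-edge updates: `StrongIH … w` gives `0 ≤ E₃` under `w[e↦0]` and `w[e↦1]` (every row, every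
injective marking) when `e` is fractional. [this work] -/
theorem StrongIH.update {Φ₁ Φ₂ Φ₃ : ι → (Fin k → Fin k → Bool) → Bool} {m : ℕ} {w : Sym2 (Fin m) → unitInterval}
    (h : StrongIH Φ₁ Φ₂ Φ₃ w) {e : Sym2 (Fin m)} (he : e ∈ frac w) (r' : ι) (x' : Fin k → Fin m) (hx' : Function.Injective x') :
    0 ≤ sahiE3 (prodBernoulli (Function.update w e 0)) (pev (Φ₁ r') x') (pev (Φ₂ r') x') (pev (Φ₃ r') x') ∧
    0 ≤ sahiE3 (prodBernoulli (Function.update w e 1)) (pev (Φ₁ r') x') (pev (Φ₂ r') x') (pev (Φ₃ r') x') :=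
  ⟨h m _ (card_frac_update_lt w he 0 (Or.inl rfl)) r' x' hx', h m _ (card_frac_update_lt w he 1 (Or.inr rfl)) r' x' hx'⟩

/-- `PinnedFamilyHyp` (step from the two updates at all markings) implies `PinnedFamilyHypStrong` (step from the strong hypothesis). [this work] -/
theorem PinnedFamilyHyp.toStrong {Φ₁ Φ₂ Φ₃ : ι → (Fin k → Fin k → Bool) → Bool} {i₀ : ι → Fin k} {m : ℕ}
    (h : PinnedFamilyHyp Φ₁ Φ₂ Φ₃ i₀ m) : PinnedFamilyHypStrong Φ₁ Φ₂ Φ₃ i₀ m :=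
  fun w r x hx u hu he IH => h w r x hx u hu (fun r' x' hx' => IH.update he r' x' hx')

/-- **THE PINNED SCHEMA WITH THE STRONG INDUCTION HYPOTHESIS.**  For a family of pattern triples with `Φ₁ r` pinned at `i₀ r` and `pev (Φ₂ r) x`,
`pev (Φ₃ r) x` positively correlated under every `prodBernoulli`: if `PinnedFamilyHypStrong Φ₁ Φ₂ Φ₃ i₀ m` holds for every `m`, then `0 ≤ E₃(row r at x)`
for every number of vertices, every weight function, every row `r` and every injective marking `x`.
Proof: prim-l12-p6's induction on the number of fractional pairs (`sahiE3_pev_nonneg_of_pinnedFamilyHyp`: clone, re-mark, expand), handing the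
step the WHOLE induction hypothesis one level down. [this work] -/
theorem sahiE3_pev_nonneg_of_pinnedFamilyHypStrong (Φ₁ Φ₂ Φ₃ : ι → (Fin k → Fin k → Bool) → Bool) (i₀ : ι → Fin k)
    (hΦ : ∀ r, PinnedPat (i₀ r) (Φ₁ r))
    (hcov : ∀ (r : ι) (m : ℕ) (w : Sym2 (Fin m) → unitInterval) (x : Fin k → Fin m),
      (prodBernoulli w).real (pev (Φ₂ r) x) * (prodBernoulli w).real (pev (Φ₃ r) x) ≤ (prodBernoulli w).real (pev (Φ₂ r) x ∩ pev (Φ₃ r) x))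
    (h : ∀ m : ℕ, PinnedFamilyHypStrong Φ₁ Φ₂ Φ₃ i₀ m)
    (w : Sym2 (Fin n) → unitInterval) (r : ι) (x : Fin k → Fin n) (hx : Function.Injective x) :
    0 ≤ sahiE3 (prodBernoulli w) (pev (Φ₁ r) x) (pev (Φ₂ r) x) (pev (Φ₃ r) x) := by
  suffices H : ∀ (M : ℕ) (n : ℕ) (w : Sym2 (Fin n) → unitInterval), (frac w).card ≤ M →
      ∀ (r : ι) (x : Fin k → Fin n), Function.Injective x → 0 ≤ sahiE3 (prodBernoulli w) (pev (Φ₁ r) x) (pev (Φ₂ r) x) (pev (Φ₃ r) x) from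
    H _ n w le_rfl r x hx
  intro M
  induction M with
  | zero =>
      intro n w hM r x _
      have hB : ¬ TouchAt w x (i₀ r) := by
        rintro ⟨z, u, -, hzu, h0, h1⟩
        have := Finset.card_pos.2 ⟨_, mem_frac hzu h0 h1⟩
        omega
      exact sahiE3_nonneg_of_not_touchAt (E₁ := fun x => pev (Φ₁ r) x) (E₂ := fun x => pev (Φ₂ r) x) (E₃ := fun x => pev (Φ₃ r) x)
        (isPinnedAt_pev (hΦ r)) w x (hcov r n w x) hB
  | succ M ih =>
      intro n w hM r x hx
      -- pass to the cloned graph (same `E₃`, no new fractional pairs, spares)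
      rw [← sahiE3_clone w x (Φ₁ r) (Φ₂ r) (Φ₃ r)]
      have hX : Function.Injective (Fin.castAdd k ∘ x) := (Fin.castAdd_injective n k).comp hx
      have hS : HasSpare (cloneWeight w x) (Fin.castAdd k ∘ x) := hasSpare_clone w x
      have hcW : (frac (cloneWeight w x)).card ≤ M + 1 := (card_frac_cloneWeight_le w x).trans hM
      by_cases hB : TouchAt (cloneWeight w x) (Fin.castAdd k ∘ x) (i₀ r)
      · obtain ⟨z, u, hiz, hzu, h0, h1⟩ := hB
        obtain ⟨X₁, hX₁, hS₁, hz₁, hT₁⟩ := exists_remark_onto (E₁ := fun x => pev (Φ₁ r) x) (E₂ := fun x => pev (Φ₂ r) x)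
          (E₃ := fun x => pev (Φ₃ r) x) (isLocal_pev _) (isLocal_pev _) (isLocal_pev _) (cloneWeight w x) hX hS (i₀ r) hiz
        obtain ⟨X₂, hX₂, -, hz₂, hu₂, hT₂⟩ := exists_remark_off (E₁ := fun x => pev (Φ₁ r) x) (E₂ := fun x => pev (Φ₂ r) x)
          (E₃ := fun x => pev (Φ₃ r) x) (isLocal_pev _) (isLocal_pev _) (isLocal_pev _) (cloneWeight w x) hX₁ hS₁ (i₀ r) (u := u)
          (by rw [hz₁]; exact hzu)
        rw [← hT₁, ← hT₂]
        have hzu' : X₂ (i₀ r) ≠ u := by rw [hz₂, hz₁]; exact hzu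
        have h0' : (0 : ℝ) < cloneWeight w x s(X₂ (i₀ r), u) := by rw [hz₂, hz₁]; exact h0
        have h1' : (cloneWeight w x s(X₂ (i₀ r), u) : ℝ) < 1 := by rw [hz₂, hz₁]; exact h1
        have he : s(X₂ (i₀ r), u) ∈ frac (cloneWeight w x) := mem_frac hzu' h0' h1'
        -- the STRONG induction hypothesis at the clone weights: every weight with fewer fractional pairs
        have IH : StrongIH Φ₁ Φ₂ Φ₃ (cloneWeight w x) := by
          intro n' w' hlt r' x' hx'
          exact ih n' w' (Nat.lt_succ_iff.1 (lt_of_lt_of_le hlt hcW)) r' x' hx'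
        have i0 := (IH.update he r X₂ hX₂).1
        have i1 := (IH.update he r X₂ hX₂).2
        obtain ⟨b1, b2⟩ := h (n + k) (cloneWeight w x) r X₂ hX₂ u hu₂ he IH
        have hp0 : (0 : ℝ) ≤ cloneWeight w x s(X₂ (i₀ r), u) := (cloneWeight w x s(X₂ (i₀ r), u)).2.1
        have hp1 : (cloneWeight w x s(X₂ (i₀ r), u) : ℝ) ≤ 1 := (cloneWeight w x s(X₂ (i₀ r), u)).2.2
        have hq : (0 : ℝ) ≤ 1 - cloneWeight w x s(X₂ (i₀ r), u) := sub_nonneg.2 hp1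
        rw [sahiE3_oneBond (cloneWeight w x) s(X₂ (i₀ r), u)]
        positivity
      · exact sahiE3_nonneg_of_not_touchAt (E₁ := fun x => pev (Φ₁ r) x) (E₂ := fun x => pev (Φ₂ r) x) (E₃ := fun x => pev (Φ₃ r) x)
          (isPinnedAt_pev (hΦ r)) (cloneWeight w x) (Fin.castAdd k ∘ x) (hcov r _ _ _) hB

/-! ### The KEY form of the step with the strong induction hypothesis (single row) -/

/-- **KEY hypotheses at the terminal `i₀` with the STRONG induction hypothesis** (single pattern row `(Φ₁, Φ₂, Φ₃)`, dimension `m`): for every `w`,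
injective `x`, unmarked `u` with `e = s(x i₀, u)` fractional: IF `0 ≤ E₃(pev Φ₁ x', pev Φ₂ x', pev Φ₃ x')` under EVERY weight `w'` (any dimension) with
fewer fractional pairs than `w` and every injective `x'` — in particular under `w[e↦0]`, `w[e↦1]` and every sure gluing of them — THEN
`0 ≤ key μ_{w[e↦0]} μ_{w[e↦1]} (pev Φ₁ x) (pev Φ₂ x) (pev Φ₃ x)`. [this work] -/
def KeyHypAtStrong (i₀ : Fin k) (Φ₁ Φ₂ Φ₃ : (Fin k → Fin k → Bool) → Bool) (m : ℕ) : Prop :=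
  ∀ (w : Sym2 (Fin m) → unitInterval) (x : Fin k → Fin m), Function.Injective x → ∀ (u : Fin m), (∀ j, x j ≠ u) →
    s(x i₀, u) ∈ frac w → StrongIH (ι := Unit) (fun _ => Φ₁) (fun _ => Φ₂) (fun _ => Φ₃) w →
    0 ≤ key (prodBernoulli (Function.update w s(x i₀, u) 0)) (prodBernoulli (Function.update w s(x i₀, u) 1))
        (pev Φ₁ x) (pev Φ₂ x) (pev Φ₃ x)

/-- **KEY (strong IH) ⇒ the strong pinned package**, for a decreasing pattern row: `B₁ ≥ 0` from `B₀ ≥ 0` and `K ≥ 0` (`polar₁_nonneg_of_key`),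
`B₂ ≥ 0` from `B₀, B₃, K ≥ 0` and `π_A π_B π_C ≥ 0` (`polar₁_swap_nonneg_of_key`, `pivotal_prod_nonneg`); `B₀, B₃ ≥ 0` are instances of the strong
hypothesis (`StrongIH.update`). [this work] -/
theorem pinnedFamilyHypStrong_of_keyHypAtStrong {i₀ : Fin k} {Φ₁ Φ₂ Φ₃ : (Fin k → Fin k → Bool) → Bool}
    (hΦ₁ : ∀ (m : ℕ) (x : Fin k → Fin m), IsLowerSet (pev Φ₁ x)) (hΦ₂ : ∀ (m : ℕ) (x : Fin k → Fin m), IsLowerSet (pev Φ₂ x))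
    (hΦ₃ : ∀ (m : ℕ) (x : Fin k → Fin m), IsLowerSet (pev Φ₃ x)) {m : ℕ} (h : KeyHypAtStrong i₀ Φ₁ Φ₂ Φ₃ m) :
    PinnedFamilyHypStrong (ι := Unit) (fun _ => Φ₁) (fun _ => Φ₂) (fun _ => Φ₃) (fun _ => i₀) m := by
  intro w r x hx u hu he IH
  have hK := h w x hx u hu he IH
  obtain ⟨i0, i1⟩ := IH.update he () x hx
  exact ⟨polar₁_nonneg_of_key i0 hK,
    polar₁_swap_nonneg_of_key i0 i1 hK (pivotal_prod_nonneg w s(x i₀, u) (hΦ₁ m x) (hΦ₂ m x) (hΦ₃ m x))⟩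

/-- **Three group separations as patterns, the FIRST pinned at `i₀` (`I₁ = [i₀]` or `J₁ = [i₀]`), from KEY with the strong induction hypothesis.** [this work] -/
theorem sahiE3_sepPat_nonneg_of_keyHypAtStrong (i₀ : Fin k) (I₁ J₁ I₂ J₂ I₃ J₃ : List (Fin k)) (hpin : I₁ = [i₀] ∨ J₁ = [i₀])
    (h : ∀ m : ℕ, KeyHypAtStrong i₀ (sepPat I₁ J₁) (sepPat I₂ J₂) (sepPat I₃ J₃) m)
    (w : Sym2 (Fin n) → unitInterval) (x : Fin k → Fin n) (hx : Function.Injective x) :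
    0 ≤ sahiE3 (prodBernoulli w) (connEvent (sep (I₁.map x) (J₁.map x))) (connEvent (sep (I₂.map x) (J₂.map x)))
      (connEvent (sep (I₃.map x) (J₃.map x))) := by
  have hΦ : PinnedPat i₀ (sepPat I₁ J₁) := by
    rcases hpin with rfl | rfl
    · exact pinnedPat_sepPat_left i₀ J₁
    · exact pinnedPat_sepPat_right i₀ I₁
  have hlow : ∀ (I J : List (Fin k)) (m : ℕ) (x : Fin k → Fin m), IsLowerSet (pev (sepPat I J) x) := by
    intro I J m x; rw [pev_sepPat]; exact isLowerSet_connEvent_sep _ _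
  rw [← pev_sepPat, ← pev_sepPat, ← pev_sepPat]
  refine sahiE3_pev_nonneg_of_pinnedFamilyHypStrong (ι := Unit) (fun _ => sepPat I₁ J₁) (fun _ => sepPat I₂ J₂) (fun _ => sepPat I₃ J₃) (fun _ => i₀)
    (fun _ => hΦ) (fun _ m w' x' => ?_) (fun m => pinnedFamilyHypStrong_of_keyHypAtStrong (hlow I₁ J₁) (hlow I₂ J₂) (hlow I₃ J₃) (h m)) w () x hx
  rw [pev_sepPat, pev_sepPat]; exact real_mul_le_inter_sep w' _ _ _ _

/-! ### Corollaries: PATH at the hub, row 44 at `a` -/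

/-- **PATH `(D[a|b], D[a|c], D[b|y])` on every finite weighted graph from `K ≥ 0` at the HUB `a`, certified with the STRONG induction hypothesis**
(all markings; degenerate markings as in `frontier_36_all_of_atAll`).  The patterns are `sepPat [0] [1], sepPat [0] [2], sepPat [1] [3]` on the four
terminal slots `(a,b,c,y) = (x 0, x 1, x 2, x 3)`. [this work] -/
theorem frontier_36_all_of_keyAtStrong_hub
    (h : ∀ m : ℕ, KeyHypAtStrong (k := 4) 0 (sepPat [0] [1]) (sepPat [0] [2]) (sepPat [1] [3]) m)
    (w : Sym2 (Fin n) → unitInterval) (a b c y : Fin n) :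
    0 ≤ sahiE3 (prodBernoulli w) (connEvent (FrontierDecRows.row 36 n (a, b, c, y)).1)
      (connEvent (FrontierDecRows.row 36 n (a, b, c, y)).2.1) (connEvent (FrontierDecRows.row 36 n (a, b, c, y)).2.2) := by
  have hr : FrontierDecRows.row 36 n (a, b, c, y) = (sep [a] [b], sep [a] [c], sep [b] [y]) := rfl
  rw [hr]
  dsimp only
  by_cases hab : a = b
  · subst hab; exact le_of_eq (sahiE3_sep_eq_zero_left (v := a) (by simp) (by simp) _ _).symm
  by_cases hac : a = c
  · subst hac; exact le_of_eq (sahiE3_sep_eq_zero_mid (v := a) (by simp) (by simp) _ _).symm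
  by_cases hby : b = y
  · subst hby; exact le_of_eq (sahiE3_sep_eq_zero_right (v := b) (by simp) (by simp) _ _).symm
  by_cases hay : a = y
  · subst hay
    rw [connEvent_sep_comm [b] [a]]
    exact sahiE3_nonneg_of_repeat₁₃ w (isLowerSet_connEvent_sep _ _) (isLowerSet_connEvent_sep _ _)
  by_cases hbc : b = c
  · subst hbc
    exact sahiE3_nonneg_of_repeat₁₂ w (isLowerSet_connEvent_sep _ _) (isLowerSet_connEvent_sep _ _)
  by_cases hcy : c = y
  · subst hcy
    rw [connEvent_sep_one_one, connEvent_sep_one_one, connEvent_sep_one_one]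
    exact ThreePointLB.sahiE3_pairSep_nonneg w a b c
  exact sahiE3_sepPat_nonneg_of_keyHypAtStrong (k := 4) 0 [0] [1] [0] [2] [1] [3] (Or.inl rfl) h w ![a, b, c, y]
    (injective_vec4 hab hac hay hbc hby hcy)

/-- **Row 44 `(D[ab|cy], D[a|b], D[c|y])` on every finite weighted graph from `K ≥ 0` at the terminal `a`, STRONG induction hypothesis.**  The
certificate is asked for the reordered triple `(D[a|b], D[ab|cy], D[c|y])` (patterns `sepPat [0] [1], sepPat [0,1] [2,3], sepPat [2] [3]`, first one
pinned at slot `0`); `E₃` is symmetric. [this work] -/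
theorem frontier_44_all_of_keyAtStrong
    (h : ∀ m : ℕ, KeyHypAtStrong (k := 4) 0 (sepPat [0] [1]) (sepPat [0, 1] [2, 3]) (sepPat [2] [3]) m)
    (w : Sym2 (Fin n) → unitInterval) (a b c y : Fin n) :
    0 ≤ sahiE3 (prodBernoulli w) (connEvent (FrontierDecRows.row 44 n (a, b, c, y)).1)
      (connEvent (FrontierDecRows.row 44 n (a, b, c, y)).2.1) (connEvent (FrontierDecRows.row 44 n (a, b, c, y)).2.2) := by
  have hr : FrontierDecRows.row 44 n (a, b, c, y) = (sep [a, b] [c, y], sep [a] [b], sep [c] [y]) := rfl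
  rw [hr]
  dsimp only
  by_cases hab : a = b
  · subst hab; exact le_of_eq (sahiE3_sep_eq_zero_mid (v := a) (by simp) (by simp) _ _).symm
  by_cases hcy : c = y
  · subst hcy; exact le_of_eq (sahiE3_sep_eq_zero_right (v := c) (by simp) (by simp) _ _).symm
  by_cases hac : a = c
  · subst hac; exact le_of_eq (sahiE3_sep_eq_zero_left (v := a) (by simp) (by simp) _ _).symm
  by_cases hay : a = y
  · subst hay; exact le_of_eq (sahiE3_sep_eq_zero_left (v := a) (by simp) (by simp) _ _).symm
  by_cases hbc : b = c
  · subst hbc; exact le_of_eq (sahiE3_sep_eq_zero_left (v := b) (by simp) (by simp) _ _).symm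
  by_cases hby : b = y
  · subst hby; exact le_of_eq (sahiE3_sep_eq_zero_left (v := b) (by simp) (by simp) _ _).symm
  rw [sahiE3_comm₁₂]
  exact sahiE3_sepPat_nonneg_of_keyHypAtStrong (k := 4) 0 [0] [1] [0, 1] [2, 3] [2] [3] (Or.inl rfl) h w ![a, b, c, y]
    (injective_vec4 hab hac hay hbc hby hcy)

end TerminalEdgeInduction

end Summit.CriticalPhenomena.PercolationContinuityZ3.Theorems
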